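import Mathlib
import Literature.AlgebraicGeometry.Resolution.RsopMonomialIdeals
import Summits.ResolutionOfSingularities.ResolutionOfSingularities.Theorems.RadicialJungCleanModelsContactChainContaining
import HarnessLib

/-!
# Route `RadicialJung`, crux `CleanModels` (stmt-ResolutionOfSingularities-15917), line `Sketch` rev 35, stub 6 `stub_cleanProp44` (X44c),
# work plan O8 / L7b — the all-transversal uncharged configuration is NEVER a `p`-th power modulo `𝓘_{C₀,x₀}²`

Pure local algebra closing L7b.  `A` local of characteristic `p`, `P = (t₀, t₁)` the span of a pair of regular parameters (`A/P` regular of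
dimension `dim A − 2`), `w ∉ P`, and `ρ = u · ∏_i s_i^{a_i}` with `s` part of a regular system of parameters, every `s_i = γ_i w^{k_i} + π_i`
TRANSVERSAL (`γ_i` a unit, `π_i ∈ P`), `p ∤ a_i`, `m ≥ 1` factors, UNCHARGED (`p ∣ Σ k_i a_i`) and with unit part `u ∏ γ_i^{a_i} ≡ c₀^p (mod P)`.
THEN `ρ − c^p ∉ P²` for every `c` (`transversal_rep_not_pow_mod_sq`).

Proof (first order along the curve, no derivations): normalise `γ_i = 1`; modulo `P²`, `∏ (w^{k_i} + π_i)^{a_i} ≡ w^N + Σ_i a_i w^{N−k_i} π_i`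
(`N = Σ k_i a_i`; `prod_pow_add_sub_mem_sq`); `c ≡ c₀ w^{N/p} (mod P)` forces `c^p ≡ c₀^p w^N (mod P²)`; so
`(V − c₀^p) w^N + V Σ_i a_i w^{N−k_i} π_i ∈ P²` (`V` the unit part).  Powers of `w` can be cancelled against `P²` (`mem_sq_of_mul_mem_sq`:
`a t₀ + b t₁ ∈ P² ⟹ a, b ∈ P`, read in the domains `A/(t_j)`), leaving, with `K = max k_i`, `Σ_{k_i = K} a_i π_i ∈ 𝔪P`; since
`π_i ≡ γ_i⁻¹ s_i − w^K` and either `K ≥ 2` (`w^K ∈ 𝔪²`) or `K = 1` (then `Σ a_i = N ≡ 0`), a unit combination of the `s_i` lies in `𝔪²` —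
impossible for part of a regular system of parameters (`rsopPart_sum_mul_not_mem_sq`).

Honest framing: OURS (elementary); nothing here proves resolution in characteristic `p`, X44c, or any case of `CleanModels`.
-/

noncomputable section

set_option linter.dupNamespace false -- mandated namespace of this single-conjunct summit

open IsLocalRing Literature.AlgebraicGeometry.Resolution

namespace Summit.ResolutionOfSingularities.ResolutionOfSingularities.Theorems.RadicialJung.CleanModels

universe u

/-- `(x + π)^{a+1} ≡ x^{a+1} + (a+1) x^a π` modulo `P²` for `π ∈ P`. [folklore] -/
theorem add_pow_succ_sub_mem_sq {A : Type u} [CommRing A] (P : Ideal A) (x π : A) (hπ : π ∈ P) (a : ℕ) :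
    (x + π) ^ (a + 1) - x ^ (a + 1) - (a + 1 : ℕ) * x ^ a * π ∈ P ^ 2 := by
  induction a with
  | zero => simp
  | succ a ih =>
    have key : (x + π) ^ (a + 1 + 1) - x ^ (a + 1 + 1) - ((a + 1 + 1 : ℕ) : A) * x ^ (a + 1) * π =
        (x + π) * ((x + π) ^ (a + 1) - x ^ (a + 1) - ((a + 1 : ℕ) : A) * x ^ a * π) + ((a + 1 : ℕ) : A) * x ^ a * π ^ 2 := by
      push_cast; ring
    rw [key]
    exact (P ^ 2).add_mem (Ideal.mul_mem_left _ _ ih) (Ideal.mul_mem_left _ _ (Ideal.pow_mem_pow hπ 2))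

/-- A member of a finite family is at most the weighted sum `Σ k_j a_j` when its weight `a_i ≥ 1`. [folklore] -/
theorem le_sum_mul_of_pos {ι : Type*} (s : Finset ι) (k a : ι → ℕ) {i : ι} (hi : i ∈ s) (ha : 0 < a i) :
    k i ≤ ∑ j ∈ s, k j * a j :=
  le_trans (Nat.le_mul_of_pos_right _ ha) (Finset.single_le_sum (f := fun j => k j * a j) (fun _ _ => Nat.zero_le _) hi)

/-- **First-order expansion of the transversal product**: for `π_i ∈ P` and `a_i ≥ 1`,
`∏_{i∈s} (w^{k_i} + π_i)^{a_i} ≡ w^N + Σ_{i∈s} a_i w^{N − k_i} π_i (mod P²)`, `N = Σ_{i∈s} k_i a_i`. [folklore] -/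
theorem prod_pow_add_sub_mem_sq {A : Type u} [CommRing A] (P : Ideal A) (w : A) {ι : Type*} [DecidableEq ι] (s : Finset ι)
    (k a : ι → ℕ) (π : ι → A) (hπ : ∀ i, π i ∈ P) (ha : ∀ i, 0 < a i) :
    (∏ i ∈ s, (w ^ k i + π i) ^ a i) - w ^ (∑ i ∈ s, k i * a i) -
      ∑ i ∈ s, (a i : A) * w ^ ((∑ j ∈ s, k j * a j) - k i) * π i ∈ P ^ 2 := by
  induction s using Finset.induction_on with
  | empty => simp
  | @insert b s hb ih =>
    set N := ∑ j ∈ s, k j * a j with hN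
    set E := (∏ i ∈ s, (w ^ k i + π i) ^ a i) - w ^ N - ∑ i ∈ s, (a i : A) * w ^ (N - k i) * π i with hE
    obtain ⟨a', ha'⟩ : ∃ a', a b = a' + 1 := ⟨a b - 1, (Nat.sub_add_cancel (ha b)).symm⟩
    have heb := add_pow_succ_sub_mem_sq P (w ^ k b) (π b) (hπ b) a'
    rw [← ha'] at heb
    set eb := (w ^ k b + π b) ^ a b - (w ^ k b) ^ a b - (a b : ℕ) * (w ^ k b) ^ a' * π b with heb_def
    have hN' : ∑ j ∈ insert b s, k j * a j = N + k b * a b := by rw [Finset.sum_insert hb, add_comm]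
    rw [hN', Finset.prod_insert hb, Finset.sum_insert hb]
    -- exponent bookkeeping
    have hkN : ∀ i ∈ s, k i ≤ N := fun i hi => le_sum_mul_of_pos s k a hi (ha i)
    have hexp1 : ∀ i ∈ s, w ^ (k b * a b) * w ^ (N - k i) = w ^ (N + k b * a b - k i) := by
      intro i hi
      rw [← pow_add]; congr 1; have := hkN i hi; omega
    have hexp2 : (w ^ k b) ^ a' * w ^ N = w ^ (N + k b * a b - k b) := by
      rw [← pow_mul, ← pow_add]; congr 1
      rw [ha']; simp [Nat.mul_succ]; omega
    have hexp3 : (w ^ k b) ^ a b * w ^ N = w ^ (N + k b * a b) := by rw [← pow_mul, ← pow_add, add_comm]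
    -- the identity
    have key : (w ^ k b + π b) ^ a b * ∏ i ∈ s, (w ^ k i + π i) ^ a i - w ^ (N + k b * a b) -
        ((a b : A) * w ^ (N + k b * a b - k b) * π b + ∑ i ∈ s, (a i : A) * w ^ (N + k b * a b - k i) * π i) =
        (w ^ k b + π b) ^ a b * E + eb * (w ^ N + ∑ i ∈ s, (a i : A) * w ^ (N - k i) * π i) +
          ((a b : ℕ) * (w ^ k b) ^ a' * π b) * (∑ i ∈ s, (a i : A) * w ^ (N - k i) * π i) := by
      rw [← hexp2, ← hexp3]
      have hsum : ∑ i ∈ s, (a i : A) * w ^ (N + k b * a b - k i) * π i =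
          (w ^ k b) ^ a b * ∑ i ∈ s, (a i : A) * w ^ (N - k i) * π i := by
        rw [Finset.mul_sum]
        refine Finset.sum_congr rfl fun i hi => ?_
        rw [← hexp1 i hi, ← pow_mul]; ring
      rw [hsum, hE, heb_def]
      ring
    rw [key]
    refine (P ^ 2).add_mem ((P ^ 2).add_mem (Ideal.mul_mem_left _ _ ih) (Ideal.mul_mem_right _ _ heb)) ?_
    -- `π_b · (Σ … π_i) ∈ P · P`
    rw [pow_two]
    refine Ideal.mul_mem_mul (Ideal.mul_mem_left _ _ (hπ b)) (Ideal.sum_mem _ fun i _ => Ideal.mul_mem_left _ _ (hπ i))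

/-- **Coefficients of an element of `P²` on the regular pair lie in `P`**: for `t = (t₀, t₁)` part of a regular system of parameters and
`P = (t₀, t₁)`, if `a · t i + b · t j ∈ P²` (`i ≠ j`) then `a ∈ P` — read modulo `t j`, where `A/(t_j)` is a domain and `t_i ≠ 0`:
`ā t̄_i ∈ (t̄_i²)` forces `t̄_i ∣ ā`. [cite: Matsumura1987, Thm. 14.2] -/
theorem rsopPair_coeff_mem_of_mem_sq {A : Type u} [CommRing A] [IsLocalRing A] {t : Fin 2 → A} (ht : IsRsopPart t) {P : Ideal A}
    (htP : Ideal.span (Set.range t) = P) {i j : Fin 2} (hij : i ≠ j) (a b : A) (h : a * t i + b * t j ∈ P ^ 2) : a ∈ P := by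
  classical
  haveI := ht.isRegularLocalRing
  -- `A/(t j)` is a domain in which `t i ≠ 0`
  set J : Ideal A := Ideal.span {t j} with hJ
  have hJrange : Ideal.span (Set.range (t ∘ fun _ : Fin 1 => j)) = J := by
    rw [hJ]; congr 1; ext x; simp [eq_comm]
  have hJprime : J.IsPrime := by
    rw [← hJrange]; exact (ht.comp (fun _ : Fin 1 => j) (fun _ _ _ => Subsingleton.elim _ _)).isPrime_span_range
  haveI : IsDomain (A ⧸ J) := Ideal.Quotient.isDomain J
  have htiJ : t i ∉ J := by
    have := ht.not_mem_span_image (S := {j}) (i := i) (by simpa using hij)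
    simpa [hJ] using this
  have hJP : J ≤ P := by
    rw [hJ, ← htP, Ideal.span_singleton_le_iff_mem]; exact Ideal.subset_span ⟨j, rfl⟩
  set mk := Ideal.Quotient.mk J with hmk
  have hti0 : mk (t i) ≠ 0 := fun h0 => htiJ (Ideal.Quotient.eq_zero_iff_mem.mp h0)
  -- `P.map mk = (mk (t i))`
  have hrange : Set.range t = {t 0, t 1} := by
    ext x
    simp only [Set.mem_range, Set.mem_insert_iff, Set.mem_singleton_iff]
    constructor
    · rintro ⟨l, rfl⟩; fin_cases l <;> simp
    · rintro (rfl | rfl) <;> exact ⟨_, rfl⟩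
  have hPmap : P.map mk = Ideal.span {mk (t i)} := by
    rw [← htP, Ideal.map_span, hrange, Set.image_pair]
    have htj0 : mk (t j) = 0 := Ideal.Quotient.eq_zero_iff_mem.mpr (Ideal.mem_span_singleton_self _)
    fin_cases i <;> fin_cases j <;> simp_all [Ideal.span_insert]
  -- read `h` modulo `J`
  have h1 : mk a * mk (t i) ∈ Ideal.span {mk (t i) ^ 2} := by
    have h2 : mk (a * t i + b * t j) ∈ (P ^ 2).map mk := Ideal.mem_map_of_mem _ h
    rw [Ideal.map_pow, hPmap, Ideal.span_singleton_pow, map_add, map_mul, map_mul,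
      Ideal.Quotient.eq_zero_iff_mem.mpr (Ideal.mem_span_singleton_self (t j) : t j ∈ J), mul_zero, add_zero] at h2
    exact h2
  obtain ⟨r, hr⟩ := Ideal.mem_span_singleton'.mp h1
  have h3 : mk a = r * mk (t i) := by
    have : (r * mk (t i) - mk a) * mk (t i) = 0 := by rw [sub_mul, mul_assoc, ← pow_two, hr, sub_self]
    rcases mul_eq_zero.mp this with h4 | h4
    · exact (sub_eq_zero.mp h4).symm
    · exact absurd h4 hti0
  have h4 : mk a ∈ P.map mk := by rw [hPmap, h3]; exact Ideal.mul_mem_left _ _ (Ideal.mem_span_singleton_self _)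
  rw [Ideal.mem_map_iff_of_surjective _ Ideal.Quotient.mk_surjective] at h4
  obtain ⟨a', ha', haa'⟩ := h4
  have h5 : a - a' ∈ J := by rw [← Ideal.Quotient.eq, haa']
  have : a = a' + (a - a') := by ring
  rw [this]
  exact P.add_mem ha' (hJP h5)

/-- **Cancelling a transversal element against `P²`**: `y ∈ P`, `w ∉ P`, `w · y ∈ P²` ⟹ `y ∈ P²` (`P = (t₀, t₁)` a regular pair, so `P/P²` is
torsion-free over the domain `A/P`). [cite: Matsumura1987, Thm. 14.2] -/
theorem mem_sq_of_mul_mem_sq {A : Type u} [CommRing A] [IsLocalRing A] {t : Fin 2 → A} (ht : IsRsopPart t) {P : Ideal A}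
    (htP : Ideal.span (Set.range t) = P) [hP : P.IsPrime] {w : A} (hw : w ∉ P) {y : A} (hy : y ∈ P) (h : w * y ∈ P ^ 2) :
    y ∈ P ^ 2 := by
  have hrange : Set.range t = {t 0, t 1} := by
    ext x
    simp only [Set.mem_range, Set.mem_insert_iff, Set.mem_singleton_iff]
    constructor
    · rintro ⟨l, rfl⟩; fin_cases l <;> simp
    · rintro (rfl | rfl) <;> exact ⟨_, rfl⟩
  have hy' : y ∈ Ideal.span ({t 0, t 1} : Set A) := by rw [← hrange, htP]; exact hy
  obtain ⟨a, b, hab⟩ := Ideal.mem_span_pair.mp hy'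
  have hwy : (w * a) * t 0 + (w * b) * t 1 ∈ P ^ 2 := by
    have : (w * a) * t 0 + (w * b) * t 1 = w * y := by rw [← hab]; ring
    rw [this]; exact h
  have ha : w * a ∈ P := rsopPair_coeff_mem_of_mem_sq ht htP (i := 0) (j := 1) (by decide) _ _ hwy
  have hb : w * b ∈ P := rsopPair_coeff_mem_of_mem_sq ht htP (i := 1) (j := 0) (by decide) _ _ (by rw [add_comm]; exact hwy)
  have ha' : a ∈ P := (hP.mem_or_mem ha).resolve_left hw
  have hb' : b ∈ P := (hP.mem_or_mem hb).resolve_left hw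
  have ht0 : t 0 ∈ P := by rw [← htP]; exact Ideal.subset_span ⟨0, rfl⟩
  have ht1 : t 1 ∈ P := by rw [← htP]; exact Ideal.subset_span ⟨1, rfl⟩
  rw [← hab, pow_two]
  exact Ideal.add_mem _ (Ideal.mul_mem_mul ha' ht0) (Ideal.mul_mem_mul hb' ht1)

/-- Iterated cancellation: `w^r · y ∈ P²`, `y ∈ P`, `w ∉ P` ⟹ `y ∈ P²`. [cite: Matsumura1987, Thm. 14.2] -/
theorem mem_sq_of_pow_mul_mem_sq {A : Type u} [CommRing A] [IsLocalRing A] {t : Fin 2 → A} (ht : IsRsopPart t) {P : Ideal A}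
    (htP : Ideal.span (Set.range t) = P) [hP : P.IsPrime] {w : A} (hw : w ∉ P) (r : ℕ) {y : A} (hy : y ∈ P)
    (h : w ^ r * y ∈ P ^ 2) : y ∈ P ^ 2 := by
  induction r with
  | zero => simpa using h
  | succ r ih =>
    apply ih
    refine mem_sq_of_mul_mem_sq ht htP hw (Ideal.mul_mem_left _ _ hy) ?_
    rw [← mul_assoc, ← pow_succ']; exact h

/-- **No unit combination of members of a regular system of parameters lies in `𝔪²`**: if `s` is part of a regular system of parameters,
`T` a set of indices containing `i₀` and `λ_{i₀}` a unit, then `Σ_{i∈T} λ_i s_i ∉ 𝔪²` (replace `s_{i₀}` by the sum: same span, still part of a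
regular system of parameters, whose members avoid `𝔪²`). [cite: Matsumura1987, Thm. 14.2] -/
theorem rsopPart_sum_mul_not_mem_sq {A : Type u} [CommRing A] [IsLocalRing A] {m : ℕ} {s : Fin m → A} (hs : IsRsopPart s)
    (T : Finset (Fin m)) (lam : Fin m → A) {i₀ : Fin m} (hi₀ : i₀ ∈ T) (hlam : IsUnit (lam i₀)) :
    ∑ i ∈ T, lam i * s i ∉ maximalIdeal A ^ 2 := by
  classical
  set S := ∑ i ∈ T, lam i * s i with hS
  set s' : Fin m → A := Function.update s i₀ S with hs'
  have hspan : Ideal.span (Set.range s') = Ideal.span (Set.range s) := by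
    apply le_antisymm
    · rw [Ideal.span_le]
      rintro _ ⟨i, rfl⟩
      by_cases hi : i = i₀
      · subst hi
        rw [hs', Function.update_self, hS]
        exact Ideal.sum_mem _ fun l _ => Ideal.mul_mem_left _ _ (Ideal.subset_span ⟨l, rfl⟩)
      · rw [hs', Function.update_of_ne hi]; exact Ideal.subset_span ⟨i, rfl⟩
    · rw [Ideal.span_le]
      rintro _ ⟨i, rfl⟩
      by_cases hi : i = i₀
      · subst hi
        have hmem : ∀ l, l ≠ i → s l ∈ Ideal.span (Set.range s') := fun l hl => by
          have : s' l = s l := by rw [hs', Function.update_of_ne hl]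
          rw [← this]; exact Ideal.subset_span ⟨l, rfl⟩
        have hSmem : S ∈ Ideal.span (Set.range s') := by
          have : s' i = S := by rw [hs', Function.update_self]
          rw [← this]; exact Ideal.subset_span ⟨i, rfl⟩
        have hdecomp : lam i * s i = S - ∑ l ∈ T.erase i, lam l * s l := by
          rw [hS, ← Finset.add_sum_erase T _ hi₀]; ring
        have h1 : lam i * s i ∈ Ideal.span (Set.range s') := by
          rw [hdecomp]
          exact Ideal.sub_mem _ hSmem (Ideal.sum_mem _ fun l hl => Ideal.mul_mem_left _ _ (hmem l (Finset.ne_of_mem_erase hl)))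
        exact (Ideal.unit_mul_mem_iff_mem _ hlam).mp h1
      · have : s' i = s i := by rw [hs', Function.update_of_ne hi]
        rw [← this]; exact Ideal.subset_span ⟨i, rfl⟩
  have hs'rsop : IsRsopPart s' := isRsopPart_of_span_eq_span hs rfl hspan
  have := hs'rsop.not_mem_sq i₀
  rw [hs', Function.update_self] at this
  exact this

/-- **The all-transversal uncharged configuration is never a `p`-th power modulo `P²`.**  See the module docstring: `P = (t₀, t₁)` the span of a regular
pair in a local ring of characteristic `p`, `w ∉ P`, `w ∈ 𝔪`; `s : Fin m → A` (`m ≥ 1`) part of a regular system of parameters with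
`s_i = γ_i w^{k_i} + π_i`, `γ_i` units, `π_i ∈ P`; `p ∤ a_i`; `Σ k_i a_i = N' p`; `u` a unit with `u ∏ γ_i^{a_i} ≡ c₀^p (mod P)`.  Then
`u ∏ s_i^{a_i} − c^p ∉ P²` for every `c`. [cite: Matsumura1987, Thm. 14.2] [cite: CossartJannsenSaito2020, proof of Thm. 6.28, Step 5] -/
theorem transversal_rep_not_pow_mod_sq {A : Type u} [CommRing A] [IsLocalRing A] (p : ℕ) [hp : Fact p.Prime] [CharP A p]
    {t : Fin 2 → A} (ht : IsRsopPart t) {P : Ideal A} (htP : Ideal.span (Set.range t) = P) [hP : P.IsPrime]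
    (w : A) (hwP : w ∉ P) (hwm : w ∈ maximalIdeal A) {m : ℕ} (hm : 0 < m) {s : Fin m → A} (hs : IsRsopPart s)
    (γ π : Fin m → A) (hγ : ∀ i, IsUnit (γ i)) (hπ : ∀ i, π i ∈ P) (k a : Fin m → ℕ) (hsk : ∀ i, s i = γ i * w ^ k i + π i)
    (ha : ∀ i, ¬ p ∣ a i) (u : A) (hu : IsUnit u) {N' : ℕ} (hN : ∑ i, k i * a i = N' * p)
    (c₀ : A) (hc₀ : u * ∏ i, γ i ^ a i - c₀ ^ p ∈ P) (c : A) :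
    u * ∏ i, s i ^ a i - c ^ p ∉ P ^ 2 := by
  classical
  intro hc
  have hPm : P ≤ maximalIdeal A := by rw [← htP]; exact ht.span_range_le_maximalIdeal
  have hP2P : P ^ 2 ≤ P := Ideal.pow_le_self two_ne_zero
  -- positivity of the exponents
  have ha0 : ∀ i, 0 < a i := fun i => Nat.pos_of_ne_zero fun h => ha i (by rw [h]; exact dvd_zero p)
  have hk0 : ∀ i, 0 < k i := by
    intro i
    by_contra h0
    have hki : k i = 0 := by omega
    have hsi : s i ∈ maximalIdeal A := hs.mem_maximalIdeal i
    rw [hsk i, hki, pow_zero, mul_one] at hsi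
    have hγi : γ i ∈ maximalIdeal A := by
      have := Ideal.sub_mem _ hsi (hPm (hπ i)); rwa [add_sub_cancel_right] at this
    exact (IsLocalRing.mem_maximalIdeal _).mp hγi (hγ i)
  -- normalise `γ_i = 1`
  set π' : Fin m → A := fun i => ↑(hγ i).unit⁻¹ * π i with hπ'def
  have hπ' : ∀ i, π' i ∈ P := fun i => Ideal.mul_mem_left _ _ (hπ i)
  have hsk' : ∀ i, s i = γ i * (w ^ k i + π' i) := by
    intro i
    rw [hsk i, hπ'def]
    simp only
    rw [mul_add, ← mul_assoc, IsUnit.mul_val_inv, one_mul]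
  set V : A := u * ∏ i, γ i ^ a i with hVdef
  have hVunit : IsUnit V := hu.mul (IsUnit.prod_univ_iff.mpr fun i => (hγ i).pow _)
  set N : ℕ := ∑ i, k i * a i with hNdef
  have hρ : u * ∏ i, s i ^ a i = V * ∏ i, (w ^ k i + π' i) ^ a i := by
    rw [hVdef, mul_assoc, ← Finset.prod_mul_distrib]
    congr 1
    exact Finset.prod_congr rfl fun i _ => by rw [hsk' i, mul_pow]
  -- the first-order expansion
  have hE := prod_pow_add_sub_mem_sq P w Finset.univ k a π' hπ' ha0
  set L : A := ∑ i, (a i : A) * w ^ (N - k i) * π' i with hLdef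
  -- `c ≡ c₀ w^{N'} (mod P)`, hence `c^p ≡ c₀^p w^N (mod P²)`
  have hρP : u * ∏ i, s i ^ a i - V * w ^ N ∈ P := by
    have h1 : V * ((∏ i, (w ^ k i + π' i) ^ a i) - w ^ N - L) ∈ P := Ideal.mul_mem_left _ _ (hP2P hE)
    have h2 : V * L ∈ P := Ideal.mul_mem_left _ _ (Ideal.sum_mem _ fun i _ => Ideal.mul_mem_left _ _ (hπ' i))
    have : u * ∏ i, s i ^ a i - V * w ^ N = V * ((∏ i, (w ^ k i + π' i) ^ a i) - w ^ N - L) + V * L := by rw [hρ]; ring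
    rw [this]; exact P.add_mem h1 h2
  have hcP : c - c₀ * w ^ N' ∈ P := by
    have h1 : (c - c₀ * w ^ N') ^ p ∈ P := by
      rw [sub_pow_char, mul_pow, ← pow_mul, ← hN]
      have : c ^ p - c₀ ^ p * w ^ N = (u * ∏ i, s i ^ a i - V * w ^ N) - (u * ∏ i, s i ^ a i - c ^ p) + (V - c₀ ^ p) * w ^ N := by ring
      rw [this]
      exact P.add_mem (P.sub_mem hρP (hP2P hc)) (Ideal.mul_mem_right _ _ hc₀)
    exact hP.mem_of_pow_mem _ h1
  have hcp : c ^ p - c₀ ^ p * w ^ N ∈ P ^ 2 := by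
    obtain ⟨πc, hπc, hcdef⟩ : ∃ πc ∈ P, c = c₀ * w ^ N' + πc := ⟨c - c₀ * w ^ N', hcP, by ring⟩
    rw [hcdef, add_pow_char, mul_pow, ← pow_mul, ← hN, add_sub_cancel_left]
    exact Ideal.pow_le_pow_right hp.out.two_le (Ideal.pow_mem_pow hπc p)
  -- `y₀ := (V − c₀^p) w^N + V L ∈ P²`
  have hy0 : (V - c₀ ^ p) * w ^ N + V * L ∈ P ^ 2 := by
    have : (V - c₀ ^ p) * w ^ N + V * L =
        (u * ∏ i, s i ^ a i - c ^ p) - V * ((∏ i, (w ^ k i + π' i) ^ a i) - w ^ N - L) + (c ^ p - c₀ ^ p * w ^ N) := by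
      rw [hρ]; ring
    rw [this]
    exact (P ^ 2).add_mem ((P ^ 2).sub_mem hc (Ideal.mul_mem_left _ _ hE)) hcp
  -- the maximal contact `K`
  obtain ⟨i₀, -, hi₀⟩ := Finset.exists_max_image Finset.univ k ⟨⟨0, hm⟩, Finset.mem_univ _⟩
  set K := k i₀ with hKdef
  have hkK : ∀ i, k i ≤ K := fun i => hi₀ i (Finset.mem_univ i)
  have hKN : K ≤ N := le_sum_mul_of_pos Finset.univ k a (Finset.mem_univ i₀) (ha0 i₀)
  have hK1 : 1 ≤ K := hk0 i₀
  -- factor `w^{N−K}`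
  set y₁ : A := (V - c₀ ^ p) * w ^ K + V * ∑ i, (a i : A) * w ^ (K - k i) * π' i with hy₁def
  have hfac : (V - c₀ ^ p) * w ^ N + V * L = w ^ (N - K) * y₁ := by
    have hwN : w ^ N = w ^ (N - K) * w ^ K := by rw [← pow_add, Nat.sub_add_cancel hKN]
    have hwi : ∀ i, w ^ (N - k i) = w ^ (N - K) * w ^ (K - k i) := fun i => by
      rw [← pow_add]; congr 1; have := hkK i; omega
    rw [hy₁def, hLdef, hwN, mul_add, Finset.mul_sum, Finset.mul_sum, Finset.mul_sum]
    congr 1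
    · ring
    · exact Finset.sum_congr rfl fun i _ => by rw [hwi i]; ring
  have hy₁P : y₁ ∈ P := by
    refine P.add_mem (Ideal.mul_mem_right _ _ hc₀) (Ideal.mul_mem_left _ _ (Ideal.sum_mem _ fun i _ => ?_))
    exact Ideal.mul_mem_left _ _ (hπ' i)
  have hy₁ : y₁ ∈ P ^ 2 := mem_sq_of_pow_mul_mem_sq ht htP hwP (N - K) hy₁P (by rw [← hfac]; exact hy0)
  -- reduce modulo `𝔪 P`
  set T : Finset (Fin m) := Finset.univ.filter fun i => k i = K with hTdef
  have hi₀T : i₀ ∈ T := by rw [hTdef, Finset.mem_filter]; exact ⟨Finset.mem_univ _, rfl⟩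
  have hmP : P ^ 2 ≤ maximalIdeal A * P := by rw [pow_two]; exact Ideal.mul_mono_left hPm
  have hz : ∑ i ∈ T, (a i : A) * π' i ∈ maximalIdeal A * P := by
    -- split the sum over `T` and its complement
    have hsplit : V * ∑ i, (a i : A) * w ^ (K - k i) * π' i =
        V * ∑ i ∈ T, (a i : A) * π' i + V * ∑ i ∈ Finset.univ.filter (fun i => ¬ k i = K), (a i : A) * w ^ (K - k i) * π' i := by
      rw [← mul_add, ← Finset.sum_filter_add_sum_filter_not Finset.univ (fun i => k i = K)]
      congr 2
      refine Finset.sum_congr rfl fun i hi => ?_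
      rw [hTdef, Finset.mem_filter] at hi
      rw [hi.2, Nat.sub_self, pow_zero, mul_one]
    have h1 : V * ∑ i ∈ T, (a i : A) * π' i =
        y₁ - (V - c₀ ^ p) * w ^ K - V * ∑ i ∈ Finset.univ.filter (fun i => ¬ k i = K), (a i : A) * w ^ (K - k i) * π' i := by
      rw [hy₁def, hsplit]; ring
    have h2 : V * ∑ i ∈ T, (a i : A) * π' i ∈ maximalIdeal A * P := by
      rw [h1]
      refine Ideal.sub_mem _ (Ideal.sub_mem _ (hmP hy₁) ?_) (Ideal.mul_mem_left _ _ (Ideal.sum_mem _ fun i hi => ?_))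
      · have hcomm : (V - c₀ ^ p) * w ^ K = w ^ K * (V - c₀ ^ p) := mul_comm _ _
        rw [hcomm]
        exact Ideal.mul_mem_mul (Ideal.pow_mem_of_mem _ hwm _ hK1) hc₀
      · rw [Finset.mem_filter] at hi
        have hlt : 1 ≤ K - k i := by have := hkK i; omega
        have : (a i : A) * w ^ (K - k i) * π' i = w ^ (K - k i) * ((a i : A) * π' i) := by ring
        rw [this]
        exact Ideal.mul_mem_mul (Ideal.pow_mem_of_mem _ hwm _ hlt) (Ideal.mul_mem_left _ _ (hπ' i))
    exact (Ideal.unit_mul_mem_iff_mem _ hVunit).mp h2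
  -- `π'_i = γ_i⁻¹ s_i − w^K` on `T`
  have hπ's : ∀ i ∈ T, (a i : A) * π' i = ((a i : A) * ↑(hγ i).unit⁻¹) * s i - (a i : A) * w ^ K := by
    intro i hi
    rw [hTdef, Finset.mem_filter] at hi
    have : π' i = ↑(hγ i).unit⁻¹ * s i - w ^ K := by
      rw [hsk' i, ← mul_assoc, IsUnit.val_inv_mul, one_mul, hi.2, add_sub_cancel_left]
    rw [this]; ring
  have hsum : ∑ i ∈ T, (a i : A) * π' i = ∑ i ∈ T, ((a i : A) * ↑(hγ i).unit⁻¹) * s i - (∑ i ∈ T, (a i : A)) * w ^ K := by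
    rw [Finset.sum_congr rfl hπ's, Finset.sum_sub_distrib, Finset.sum_mul]
  have hm2 : maximalIdeal A * P ≤ maximalIdeal A ^ 2 := by rw [pow_two]; exact Ideal.mul_mono_right hPm
  have hunit : IsUnit ((a i₀ : A) * ↑(hγ i₀).unit⁻¹) := (isUnit_natCast_of_not_dvd p (ha i₀)).mul (Units.isUnit _)
  -- the `w^K` term lies in `𝔪²`: either `K ≥ 2`, or `K = 1` and `Σ a_i = N ≡ 0`
  have hwK : (∑ i ∈ T, (a i : A)) * w ^ K ∈ maximalIdeal A ^ 2 := by
    by_cases hK2 : 2 ≤ K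
    · exact Ideal.mul_mem_left _ _ (Ideal.pow_le_pow_right hK2 (Ideal.pow_mem_pow hwm K))
    · have hK : K = 1 := by omega
      have hall : ∀ i, k i = 1 := fun i => le_antisymm (hK ▸ hkK i) (hk0 i)
      have hT : T = Finset.univ := by
        rw [hTdef]; exact Finset.filter_true_of_mem fun i _ => by rw [hall i, hK]
      have hsumN : (∑ i ∈ T, (a i : A)) = (N : A) := by
        rw [hT, hNdef]; push_cast
        exact Finset.sum_congr rfl fun i _ => by rw [hall i]; simp
      rw [hsumN, hN]; push_cast
      rw [CharP.cast_eq_zero A p, mul_zero, zero_mul]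
      exact Ideal.zero_mem _
  have hfinal : ∑ i ∈ T, ((a i : A) * ↑(hγ i).unit⁻¹) * s i ∈ maximalIdeal A ^ 2 := by
    have : ∑ i ∈ T, ((a i : A) * ↑(hγ i).unit⁻¹) * s i = ∑ i ∈ T, (a i : A) * π' i + (∑ i ∈ T, (a i : A)) * w ^ K := by
      rw [hsum]; ring
    rw [this]
    exact Ideal.add_mem _ (hm2 hz) hwK
  exact rsopPart_sum_mul_not_mem_sq hs T (fun i => (a i : A) * ↑(hγ i).unit⁻¹) hi₀T hunit hfinal

end Summit.ResolutionOfSingularities.ResolutionOfSingularities.Theorems.RadicialJung.CleanModels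

end
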